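import Literature.MathematicalPhysics.QuantumFieldTheory.Balaban1983to89.Node00.Record12ContT
import Literature.MathematicalPhysics.QuantumFieldTheory.Balaban1983to89.B12NodeKnitContinuousTransport

/-!
# NODE 00 (YM-PLAN Track A) — THE ON-DOMAIN CONTINUOUS-VERSION TRANSPORT OF RECORD `TcOnOfRecord` (K0′ component P7, the object behind a
# print-shaped `contT`): ALWAYS a version of the (0.13)∕(3.1) kernel transform — hence ALWAYS a renormalisation transformation —, continuous ON the
# small-field domain of the next step exactly when the on-domain proviso holds, and pointwise DETERMINED there

Cell `pub-ymgap`, NODE 00, seat `pub-ymgap-node00-def-K0e` (prover; K0′ row P7 `contT`), FILE 2 — the object that this seat's located finding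
[NODE00-K0E-G0-LOCATED-1] (L-K0e-3) says a print-shaped re-typing of the β-version proviso needs.  OFFERED to the type owner (node00-def-T) and the
plan; it defines NO record predicate and re-points NOTHING of record (as def-χ's `chiFixed7` ∕ `betaOfRecord₈χ` were offered).  [I] = [Balaban1987RG1],
[III] = [Balaban1988Convergent].  Imports FILE 1 (`Node00.Record12ContT`: `HasContVersionOn`, `HasContTransportOn`, `Stage8Params.HasContTransportAlongDom`)
and n09-a's `B12NodeKnitContinuousTransport` (integrability bookkeeping of the (0.19) densities; its import `B12ContinuousTransportInvarianceOn` is FILE 1's).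

WHY.  def-T's continuous-version transport `TcOfRecord ρ := contVersion (piHaar) (transportOfRecord ρ)` (`Node00.ContinuousTransportOfRecord`) is THE
continuous function in the a.e.-class of the kernel transform when the class has one ON THE WHOLE configuration space, and the junk `0` otherwise; so
(i) it is a renormalisation transformation of `ρ` (`isRT_TcOfRecord`) ONLY under the everywhere proviso, and (ii) the record's β reads junk off it.  Print
reads `A_{k+1} = log 𝐍_k⁻¹(T_kρ_k)` on the small-field domain `|∂V − 1| < ε₀` of step `k+1` only ([I] p. 259, (1.2) p. 260), where Theorem 1 [III] makes it
analytic; FILE 1 located that the everywhere proviso has no print locator.  THIS FILE builds the transport whose GOOD PROPERTIES DO NOT WAIT for any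
continuity statement: at torus `K`, step `k`, density `ρ`,
  `TcOnOfRecord ν K k ρ := V ↦ if V ∈ domAltOfRecord ν K (k+1) then g(V) else (transportOfRecord ρ)(V)`
with `g` a version of the kernel transform continuous ON the domain when one exists (else the kernel transform itself).  Consequently:
* `TcOnOfRecord_ae_eq`: it is ALWAYS a version of the kernel transform (a.e. on the domain by choice of `g`, verbatim off it) — so `isRT_TcOnOfRecord`
  (every integrable `ρ`, every `k < K`) and `integrable_TcOnOfRecord` carry NO continuity proviso (contrast `isRT_TcOfRecord`);
* `continuousOn_TcOnOfRecord`: continuous ON `domAltOfRecord ν K (k+1)` under the ON-DOMAIN proviso `HasContTransportOn … (domAltOfRecord ν K (k+1))` — the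
  print-shaped statement (FILE 1 §5 derives it from [III] (ii) + chart data + the (0.19)∕(2.23) identification);
* `TcOnOfRecord_eqOn_of_continuousOn`: on the (open) domain it EQUALS every continuous-on-domain a.e.-representative — e.g. print's `𝐍_k e^{A_{k+1}}` — at
  EVERY point (Mathlib `Measure.eqOn_open_of_ae_eq`; product Haar charges open sets): POINTWISE DETERMINACY where print reads the values;
* `TcOnOfRecord_eq_of_not_mem`: off the domain it IS the kernel transform (a version-valued object no face of print reads).

CONTENT.  §1 generic `contVersionOn μ f s` (+ `_ae_eq` UNCONDITIONAL, `_ae_eq_restrict`, `continuousOn_`, `_of_not`, `_eq_of_not_mem`, determinacy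
`_eqOn_of_continuousOn`, version-independence `_eqOn_congr_ae`, `integrable_`).  §2 gauge-generic `transportCOn avg ρ s` (+ `_ae_eq`, `isRT_transportCOn`
UNCONDITIONAL in any existence hypothesis, `integrable_`, `continuousOn_`, `_eqOn_of_continuousOn`).  §3 at the record: `TcOnOfRecord ν : Transport F N` and the
five faces above.  §4 along the β-layer (def-χ's `chiFixed7 ν` in the χ slot): `abs_integrand_le_exp`; **`integrable_integrand_TcOnOfRecord`** — every (0.19)
density met along `TcOnOfRecord ν`, `k ≤ K`, is integrable, by DOMINATION `|ρ_{k+1}| ≤ |𝐍_k⁻¹·(TcOn ρ_k)| + 1` (n09-a's compactness bound is unavailable: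
on-domain versions need not be bounded); `isRT_TcOnOfRecord_beta` (UNCONDITIONAL `IsRT` at every β-input, `k < K`); the θ-level proviso a successor record
would carry INSTEAD of `contT`: **`Stage8Params.ContTOnDom θ := θ.HasContTransportAlongDom (TcOnOfRecord θ.ν)`**; **`stepsOn_TcOnOfRecord`** (from
`ContTOnDom`: n09-a's per-step triple «`IsRT` ∧ `Integrable` ∧ `ContinuousOn … (domAltOfRecord ν K (j+1))`» at every `j < K`) and
`hCompT_TcOnOfRecord_of_contTOnDom` (N09's composition input over `TcOnOfRecord` = n09-a's `hCompT_of_stepsOn_chiFixed7` fed); the β over it,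
`betaOfRecord₈cOn` ∕ `betaOfRecord₉cOn` (OFFERED, bound by no record).

HONEST FRAMING: definitions + kernel-checked bookkeeping (Mathlib: uniqueness of continuous versions on open sets, `Integrable.congr`∕`mono'`); nothing of
Bałaban's asserted; no estimate; everywhere-continuity (`HasContTransportAlong`, the record's field) is NEITHER refuted NOR proved here — this module supplies the
print-shaped ON-DOMAIN transport, and the record of record (`Record12`) still carries the everywhere field until a successor record re-types it (type owner's
word [NODE00-DEF-T-G4-WORD-K0e-OFFER], pub-ymgap INBOX 2026-08-26); open-positivity of product Haar measure enters only through def-T's tree lemma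
`isOpenPosMeasure_piHaar_SUN` (§3) or as the displayed instance hypothesis of the generic §1∕§2 lemmas — no instance is declared; the on-domain proviso `ContTOnDom` is DISPLAYED, never asserted (its print content is [III] Thm 1 + [B11] Thm 1 + (0.19) on
versions, FILE 1 (L-K0e-2)); whether a successor record adopts `TcOnOfRecord`∕`ContTOnDom` is the type owner's decision; counts unmoved (typed 28∕28 ·
discharged 5∕28); K0′ NOT closed, `contT` NOT discharged; one finite four-torus programme at fixed `ε = L^{−K}` — NOT continuum ∕ ℝ⁴ ∕ OS ∕ mass gap ∕ Clay.
No `sorry`, no `axiom`, no `instance`, no `notation`.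
-/

noncomputable section

open MeasureTheory Set
open scoped BigOperators

namespace Literature.MathematicalPhysics.QuantumFieldTheory.Balaban1983to89.Node00

open _root_.Topology
open T4Continuum (T4Family)
open FlowStep (HBeta)
open B12Eq019ActionBody (integrand integrand_apply nextAction_apply normConst)
open T4AveragingDisintegration (transportK kernelTransport isRT_kernelTransport integrable_kernelTransport)
open T4FiniteEpsInhabited (HaarAC)
open B12ContinuousTransportInvarianceOn (isOpen_domAltOfRecord hCompT_of_stepsOn_chiFixed7)
open B12NodeKnitContinuousTransport (measurable_gfOfRecord gfOfRecord_nonneg chiFixed7_le_one integrable_integrand_TcOfRecord)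

/-! ## §1. The on-domain continuous version of an a.e.-defined real function (generic) -/

section Generic

variable {α : Type*} [TopologicalSpace α] [MeasurableSpace α] {μ : Measure α} {f : α → ℝ} {s : Set α}

open Classical in
/-- **THE ON-DOMAIN CONTINUOUS VERSION** of `f` on `s` w.r.t. `μ`: `f` modified ON `s` to a version continuous on `s` when `f` has one there
(`HasContVersionOn`, FILE 1), UNCHANGED off `s`; `f` itself when there is none.  By construction ALWAYS a.e. equal to `f` (`contVersionOn_ae_eq`).
[cite: Balaban1987RG1, (0.13) p.254 and p.259 (bookkeeping: the transform read on the small-field domain)] -/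
def contVersionOn (μ : Measure α) (f : α → ℝ) (s : Set α) : α → ℝ :=
  if h : HasContVersionOn μ f s then (fun x => if x ∈ s then h.choose x else f x) else f

/-- No version continuous on `s` ⇒ `contVersionOn μ f s = f`. [cite: Balaban1987RG1, (0.13) p.254 (bookkeeping)] -/
theorem contVersionOn_of_not (h : ¬ HasContVersionOn μ f s) : contVersionOn μ f s = f := by
  unfold contVersionOn; rw [dif_neg h]

open Classical in
/-- Off the domain the on-domain version IS `f` (both branches). [cite: Balaban1987RG1, (0.13) p.254 (bookkeeping)] -/
theorem contVersionOn_eq_of_not_mem {x : α} (hx : x ∉ s) : contVersionOn μ f s x = f x := by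
  unfold contVersionOn
  by_cases h : HasContVersionOn μ f s
  · rw [dif_pos h]
    show (if x ∈ s then h.choose x else f x) = f x
    rw [if_neg hx]
  · rw [dif_neg h]

open Classical in
/-- On the domain, when a version continuous on `s` exists, `contVersionOn μ f s` is the chosen one. [cite: Balaban1987RG1, (0.13) p.254 (bookkeeping)] -/
theorem contVersionOn_eqOn_choose (h : HasContVersionOn μ f s) : EqOn (contVersionOn μ f s) h.choose s := fun x hx => by
  unfold contVersionOn; rw [dif_pos h]
  show (if x ∈ s then h.choose x else f x) = h.choose x
  rw [if_pos hx]

/-- Under the on-domain existence hypothesis the on-domain version is continuous ON `s`. [cite: Balaban1987RG1, (0.13) p.254 and p.259 (bookkeeping)] -/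
theorem continuousOn_contVersionOn (h : HasContVersionOn μ f s) : ContinuousOn (contVersionOn μ f s) s :=
  h.choose_spec.1.congr (contVersionOn_eqOn_choose h)

/-- **THE ON-DOMAIN VERSION IS ALWAYS A VERSION**: `contVersionOn μ f s = f` `μ`-a.e. — UNCONDITIONALLY (a.e. on `s` by the choice, verbatim off `s`; and
`= f` outright when no on-domain version exists). [cite: Balaban1987RG1, (0.13) p.254 (bookkeeping)] -/
theorem contVersionOn_ae_eq : contVersionOn μ f s =ᵐ[μ] f := by
  by_cases h : HasContVersionOn μ f s
  · have h2 : ∀ᵐ x ∂μ, x ∈ s → h.choose x = f x := ae_imp_of_ae_restrict h.choose_spec.2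
    filter_upwards [h2] with x hx
    by_cases hxs : x ∈ s
    · rw [contVersionOn_eqOn_choose h hxs]; exact hx hxs
    · exact contVersionOn_eq_of_not_mem hxs
  · rw [contVersionOn_of_not h]

/-- … in particular a.e. on the domain. [cite: Balaban1987RG1, (0.13) p.254 (bookkeeping)] -/
theorem contVersionOn_ae_eq_restrict : contVersionOn μ f s =ᵐ[μ.restrict s] f :=
  ae_restrict_of_ae contVersionOn_ae_eq

/-- **DETERMINACY ON AN OPEN DOMAIN**: for `s` open and `μ` charging every non-empty open set, ANY function continuous on `s` and a.e. equal to `f` on `s`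
EQUALS `contVersionOn μ f s` at EVERY point of `s` (Mathlib `Measure.eqOn_open_of_ae_eq`). [cite: Balaban1987RG1, (0.13) p.254 and p.259 (bookkeeping)] -/
theorem contVersionOn_eqOn_of_continuousOn [μ.IsOpenPosMeasure] (hs : IsOpen s) {g : α → ℝ} (hg : ContinuousOn g s)
    (hae : g =ᵐ[μ.restrict s] f) : EqOn (contVersionOn μ f s) g s :=
  have h : HasContVersionOn μ f s := ⟨g, hg, hae⟩
  Measure.eqOn_open_of_ae_eq (contVersionOn_ae_eq_restrict.trans hae.symm) hs (continuousOn_contVersionOn h) hg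

/-- **VERSION-INDEPENDENCE ON AN OPEN DOMAIN**: two a.e.-representatives (on `s`) having an on-domain continuous version get THE SAME on-domain version,
pointwise on `s`. [cite: Balaban1987RG1, (0.13) p.254 (bookkeeping)] -/
theorem contVersionOn_eqOn_congr_ae [μ.IsOpenPosMeasure] (hs : IsOpen s) {f₁ f₂ : α → ℝ} (h₁ : HasContVersionOn μ f₁ s)
    (h : f₁ =ᵐ[μ.restrict s] f₂) : EqOn (contVersionOn μ f₁ s) (contVersionOn μ f₂ s) s :=
  (contVersionOn_eqOn_of_continuousOn hs (continuousOn_contVersionOn h₁) (contVersionOn_ae_eq_restrict.trans h)).symm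

/-- Integrability passes to the on-domain version (it is a version). [cite: Balaban1987RG1, (0.13) p.254 (bookkeeping)] -/
theorem integrable_contVersionOn (hf : Integrable f μ) : Integrable (contVersionOn μ f s) μ :=
  hf.congr contVersionOn_ae_eq.symm

end Generic

/-! ## §2. The on-domain continuous-version transport on lattice gauge fields (generic gauge group) -/

section Gauge

variable {P : Params} {j : ℕ} {G : Type*} [GaugeGroup G] [MeasurableSpace G] [HaarData G] [TopologicalSpace G] [StandardBorelSpace G]

/-- **THE ON-DOMAIN CONTINUOUS-VERSION TRANSPORT** of a density `ρ` along an averaging map, domain `s` of coarse fields: the kernel transport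
`transportK avg ρ` ((0.13) read as the one-step disintegration kernel) modified ON `s` to a version continuous on `s` when it has one (Pi topology, product
Haar measure `piHaar`). [cite: Balaban1987RG1, (0.13) p.254 and p.259; Balaban1988Convergent, (3.1) p.264] -/
def transportCOn (avg : GaugeField P j G → GaugeField P (j + 1) G) (ρ : Density P j G) (s : Set (PBond P (j + 1) → G)) : Density P (j + 1) G :=
  contVersionOn (α := PBond P (j + 1) → G) (piHaar P (j + 1) G) (fun V => transportK avg ρ V) s

/-- It is ALWAYS a version of the kernel transport. [cite: Balaban1987RG1, (0.13) p.254 (bookkeeping)] -/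
theorem transportCOn_ae_eq (avg : GaugeField P j G → GaugeField P (j + 1) G) (ρ : Density P j G) (s : Set (PBond P (j + 1) → G)) :
    (fun V : PBond P (j + 1) → G => transportCOn avg ρ s V) =ᵐ[piHaar P (j + 1) G] (fun V => transportK avg ρ V) :=
  contVersionOn_ae_eq

/-- **IT IS A RENORMALISATION TRANSFORMATION of every integrable `ρ`** (measurable averaging with `HaarAC`) — with NO continuity hypothesis: the push-forward
identity of the kernel transport transferred along the a.e.-equality. [cite: Balaban1985Averaging, (10) p.19; Balaban1987RG1, (0.13) p.254] -/
theorem isRT_transportCOn {avg : GaugeField P j G → GaugeField P (j + 1) G} (havg : Measurable avg) (hac : HaarAC avg) {ρ : Density P j G}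
    (hρ : Integrable ρ (fieldMeasure P j G)) (s : Set (PBond P (j + 1) → G)) : IsRT avg ρ (transportCOn avg ρ s) := by
  intro f hf hfC
  rw [← isRT_kernelTransport havg hac ρ hρ f hf hfC]
  refine integral_congr_ae ?_
  exact (transportCOn_ae_eq avg ρ s).mono fun V hV => congrArg (· * f V) hV

/-- The on-domain transport of an integrable density is integrable. [cite: Balaban1987RG1, (0.13) p.254 (bookkeeping)] -/
theorem integrable_transportCOn {avg : GaugeField P j G → GaugeField P (j + 1) G} (havg : Measurable avg) (hac : HaarAC avg) {ρ : Density P j G}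
    (hρ : Integrable ρ (fieldMeasure P j G)) (s : Set (PBond P (j + 1) → G)) : Integrable (transportCOn avg ρ s) (fieldMeasure P (j + 1) G) :=
  (integrable_kernelTransport (fieldMeasure P j G) (fieldMeasure P (j + 1) G) havg hac hρ).congr (transportCOn_ae_eq avg ρ s).symm

/-- Under the ON-DOMAIN existence hypothesis it is continuous ON the domain. [cite: Balaban1987RG1, (0.13) p.254 and p.259 (bookkeeping)] -/
theorem continuousOn_transportCOn {avg : GaugeField P j G → GaugeField P (j + 1) G} {ρ : Density P j G} {s : Set (PBond P (j + 1) → G)}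
    (hex : HasContVersionOn (piHaar P (j + 1) G) (fun V => transportK avg ρ V) s) :
    ContinuousOn (fun V : PBond P (j + 1) → G => transportCOn avg ρ s V) s :=
  continuousOn_contVersionOn hex

/-- **DETERMINACY on an open domain**: any continuous-on-`s` a.e.-representative of the kernel transport IS `transportCOn avg ρ s` on `s`.
[cite: Balaban1987RG1, (0.13) p.254 (bookkeeping)] -/
theorem transportCOn_eqOn_of_continuousOn [(piHaar P (j + 1) G).IsOpenPosMeasure] {avg : GaugeField P j G → GaugeField P (j + 1) G}
    {ρ : Density P j G} {s : Set (PBond P (j + 1) → G)} (hs : IsOpen s) {g : (PBond P (j + 1) → G) → ℝ} (hg : ContinuousOn g s)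
    (hae : g =ᵐ[(piHaar P (j + 1) G).restrict s] fun V => transportK avg ρ V) : EqOn (transportCOn avg ρ s) g s :=
  contVersionOn_eqOn_of_continuousOn hs hg hae

/-- Off the domain it IS the kernel transport. [cite: Balaban1987RG1, (0.13) p.254 (bookkeeping)] -/
theorem transportCOn_eq_of_not_mem {avg : GaugeField P j G → GaugeField P (j + 1) G} {ρ : Density P j G} {s : Set (PBond P (j + 1) → G)}
    {V : PBond P (j + 1) → G} (hV : V ∉ s) : transportCOn avg ρ s V = transportK avg ρ V :=
  contVersionOn_eq_of_not_mem hV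

end Gauge

/-! ## §3. At the record: `G = SU(N)`, the averaging of record, domain = the small-field domain of record of the NEXT step -/

section Record

variable (F : T4Family) (N : ℕ) [NeZero N]

/-- **THE ON-DOMAIN CONTINUOUS-VERSION TRANSPORT OF RECORD** as a transport family (def-B's `Transport F N`), keyed by the numerics `ν` (threshold `ε₀`): per
torus `K` and step `k`, the kernel transform of record along `avOfRecord F N K k` modified on `domAltOfRecord ν K (k+1)` = «|∂V − 1| < ε₀ on T₁^{(k+1)}» to a
version continuous there, when it has one. [cite: Balaban1987RG1, (0.13) p.254, (0.19) p.255 and p.259] -/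
def TcOnOfRecord (ν : Stage7Numerics) : Transport F N :=
  fun K k ρ => transportCOn (avOfRecord F N K k).avg ρ (domAltOfRecord F N ν K (k + 1))

variable {F N}

/-- Unfolding (`rfl`). [cite: Balaban1987RG1, (0.13) p.254 (bookkeeping)] -/
theorem TcOnOfRecord_apply (ν : Stage7Numerics) (K k : ℕ) (ρ : Density (F.P K) k (SU N)) :
    TcOnOfRecord F N ν K k ρ =
      contVersionOn (piHaar (F.P K) (k + 1) (SU N)) (fun V => transportOfRecord F N K k ρ V) (domAltOfRecord F N ν K (k + 1)) := rfl

/-- **ALWAYS A VERSION OF THE TRANSFORM OF RECORD** (no proviso). [cite: Balaban1987RG1, (0.13) p.254; Balaban1988Convergent, (3.1) p.264] -/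
theorem TcOnOfRecord_ae_eq (ν : Stage7Numerics) (K k : ℕ) (ρ : Density (F.P K) k (SU N)) :
    (fun V : PBond (F.P K) (k + 1) → SU N => TcOnOfRecord F N ν K k ρ V) =ᵐ[piHaar (F.P K) (k + 1) (SU N)]
      (fun V => transportOfRecord F N K k ρ V) :=
  transportCOn_ae_eq _ _ _

/-- **ALWAYS A RENORMALISATION TRANSFORMATION** of every integrable `ρ`, at every step `k < K` — NO continuity proviso (contrast def-T's
`isRT_TcOfRecord`, which needs the everywhere proviso). [cite: Balaban1985Averaging, (10) p.19; Balaban1988Convergent, (3.1) p.264] -/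
theorem isRT_TcOnOfRecord (ν : Stage7Numerics) {K k : ℕ} (hk : k < K) {ρ : Density (F.P K) k (SU N)}
    (hρ : Integrable ρ (fieldMeasure (F.P K) k (SU N))) : IsRT (avOfRecord F N K k).avg ρ (TcOnOfRecord F N ν K k ρ) :=
  isRT_transportCOn (avOfRecord_measurable F N K k) (avOfRecord_haarAC F N K k hk) hρ _

/-- Its images of integrable densities are integrable, `k < K`. [cite: Balaban1988Convergent, (3.1) p.264 (bookkeeping)] -/
theorem integrable_TcOnOfRecord (ν : Stage7Numerics) {K k : ℕ} (hk : k < K) {ρ : Density (F.P K) k (SU N)}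
    (hρ : Integrable ρ (fieldMeasure (F.P K) k (SU N))) : Integrable (TcOnOfRecord F N ν K k ρ) (fieldMeasure (F.P K) (k + 1) (SU N)) :=
  integrable_transportCOn (avOfRecord_measurable F N K k) (avOfRecord_haarAC F N K k hk) hρ _

/-- **CONTINUOUS ON THE SMALL-FIELD DOMAIN OF THE NEXT STEP under the ON-DOMAIN proviso** (FILE 1's `HasContTransportOn` at `domAltOfRecord ν K (k+1)`).
[cite: Balaban1987RG1, p.259 and (1.2) p.260] -/
theorem continuousOn_TcOnOfRecord (ν : Stage7Numerics) {K k : ℕ} {ρ : Density (F.P K) k (SU N)}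
    (h : HasContTransportOn F N K k ρ (domAltOfRecord F N ν K (k + 1))) :
    ContinuousOn (fun V : PBond (F.P K) (k + 1) → SU N => TcOnOfRecord F N ν K k ρ V) (domAltOfRecord F N ν K (k + 1)) :=
  continuousOn_transportCOn h

/-- **POINTWISE DETERMINACY ON THE DOMAIN**: ANY function continuous on `domAltOfRecord ν K (k+1)` and a.e. equal there to the transform of record of `ρ` — e.g.
print's `𝐍_k·exp A_{k+1}` — EQUALS `TcOnOfRecord ν K k ρ` at EVERY point of the domain (the domain is open: n09-a's `isOpen_domAltOfRecord`; product Haar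
charges open sets: def-T's `isOpenPosMeasure_piHaar_SUN`). [cite: Balaban1987RG1, (0.19) p.255 and p.259] -/
theorem TcOnOfRecord_eqOn_of_continuousOn (ν : Stage7Numerics) {K k : ℕ} {ρ : Density (F.P K) k (SU N)} {g : (PBond (F.P K) (k + 1) → SU N) → ℝ}
    (hg : ContinuousOn g (domAltOfRecord F N ν K (k + 1)))
    (hae : g =ᵐ[(piHaar (F.P K) (k + 1) (SU N)).restrict (domAltOfRecord F N ν K (k + 1))] fun V => transportOfRecord F N K k ρ V) :
    EqOn (TcOnOfRecord F N ν K k ρ) g (domAltOfRecord F N ν K (k + 1)) :=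
  haveI := isOpenPosMeasure_piHaar_SUN N (F.P K) (k + 1)
  transportCOn_eqOn_of_continuousOn (isOpen_domAltOfRecord ν K (k + 1)) hg hae

/-- Off the domain `TcOnOfRecord` IS the transform of record (version-valued; read by no face of print). [cite: Balaban1987RG1, (0.13) p.254 (bookkeeping)] -/
theorem TcOnOfRecord_eq_of_not_mem (ν : Stage7Numerics) {K k : ℕ} (ρ : Density (F.P K) k (SU N)) {V : PBond (F.P K) (k + 1) → SU N}
    (hV : V ∉ domAltOfRecord F N ν K (k + 1)) : TcOnOfRecord F N ν K k ρ V = transportOfRecord F N K k ρ V :=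
  transportCOn_eq_of_not_mem hV

end Record

/-! ## §4. Along the β-layer: integrability by domination, unconditional `IsRT`, the successor's proviso `ContTOnDom`, and N09's per-step triple -/

section Beta

variable {F : T4Family} {N : ℕ} [NeZero N]

omit [NeZero N] in
/-- Pointwise bound of the (0.19) density: for `χ ∈ [0,1]` and `GF ≥ 0`, `|χ(U)·exp[−GF(U)/g² + A(U)]| ≤ exp A(U)` (the gauge-fixing exponent is `≤ 0`, also at the
junk coupling `g = 0` where `1/0 = 0`). [cite: Balaban1987RG1, (0.19) p.255] -/
theorem abs_integrand_le_exp {P : Params} {k : ℕ} {χ GF A : Density P k (SU N)} (hχ0 : ∀ U, 0 ≤ χ U) (hχ1 : ∀ U, χ U ≤ 1) (hGF : ∀ U, 0 ≤ GF U)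
    (gk : ℝ) (U : GaugeField P k (SU N)) : |integrand χ GF gk A U| ≤ Real.exp (A U) := by
  rw [integrand_apply, abs_mul, abs_of_nonneg (hχ0 U), Real.abs_exp, Real.exp_add]
  have h1 : Real.exp (-(1 / gk ^ 2) * GF U) ≤ 1 := by
    refine Real.exp_le_one_iff.2 ?_
    have : 0 ≤ 1 / gk ^ 2 * GF U := mul_nonneg (one_div_nonneg.2 (sq_nonneg _)) (hGF U)
    linarith
  calc χ U * (Real.exp (-(1 / gk ^ 2) * GF U) * Real.exp (A U))
      ≤ 1 * (1 * Real.exp (A U)) := by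
        refine mul_le_mul (hχ1 U) (mul_le_mul_of_nonneg_right h1 (Real.exp_pos _).le) ?_ zero_le_one
        exact mul_nonneg (Real.exp_pos _).le (Real.exp_pos _).le
    _ = Real.exp (A U) := by ring

omit [NeZero N] in
/-- `exp (log x) ≤ |x| + 1` (private plumbing). [folklore] -/
private theorem exp_log_le_abs_add_one (x : ℝ) : Real.exp (Real.log x) ≤ |x| + 1 := by
  by_cases hx : x = 0
  · rw [hx, Real.log_zero, Real.exp_zero]; simp
  · rw [Real.exp_log_eq_abs hx]; linarith [abs_nonneg x]

/-- **EVERY (0.19) DENSITY MET ALONG `TcOnOfRecord ν` IS INTEGRABLE**, `k ≤ K` (def-χ's `chiFixed7 ν` in the χ slot): `ρ_0 = χ_0 e^{−GF/g_0² − (1/g_0²)A}` is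
bounded; `|ρ_{k+1}| ≤ exp A_{k+1} = exp log(𝐍_k⁻¹·TcOn ρ_k) ≤ |𝐍_k⁻¹·TcOn ρ_k| + 1`, an integrable dominant since `TcOn ρ_k` is a version of the kernel
transform of the integrable `ρ_k` (`k < K`).  (n09-a's bound for `TcOfRecord` used boundedness of continuous images on the compact configuration space; the
on-domain transport is not bounded in general, so DOMINATION replaces it.) [cite: Balaban1987RG1, (0.17)–(0.19) p.255] -/
theorem integrable_integrand_TcOnOfRecord (ν : Stage7Numerics) (K : ℕ) (g : ℕ → ℝ) :
    ∀ {k : ℕ}, k ≤ K →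
      Integrable (integrand (chiFixed7 F N ν K g k) (gfOfRecord F N K k) (g k) (effActionHT F N (TcOnOfRecord F N ν) (chiFixed7 F N ν) K g k))
        (fieldMeasure (F.P K) k (SU N))
  | 0, _ => by
    simpa only [effActionHT_zero] using integrable_integrand_TcOfRecord (F := F) (N := N) ν K g 0
  | k + 1, hk => by
    have hk' : k < K := Nat.lt_of_succ_le hk
    -- the previous density and the integrability of its on-domain transform
    have hρ := integrable_integrand_TcOnOfRecord ν K g hk'.le
    have hT : Integrable (TcOnOfRecord F N ν K k (integrand (chiFixed7 F N ν K g k) (gfOfRecord F N K k) (g k)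
        (effActionHT F N (TcOnOfRecord F N ν) (chiFixed7 F N ν) K g k))) (fieldMeasure (F.P K) (k + 1) (SU N)) :=
      integrable_TcOnOfRecord ν hk' hρ
    set c : ℝ := (normConst (TcOnOfRecord F N ν K k) (chiFixed7 F N ν K g k) (gfOfRecord F N K k) (g k)
      (effActionHT F N (TcOnOfRecord F N ν) (chiFixed7 F N ν) K g k))⁻¹ with hc
    -- `A_{k+1} = log (c · TcOn ρ_k)` is a.e.-measurable
    have hA : AEMeasurable (effActionHT F N (TcOnOfRecord F N ν) (chiFixed7 F N ν) K g (k + 1)) (fieldMeasure (F.P K) (k + 1) (SU N)) := by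
      rw [effActionHT_succ]
      exact Real.measurable_log.comp_aemeasurable (hT.1.aemeasurable.const_mul c)
    have hmeas : AEStronglyMeasurable (integrand (chiFixed7 F N ν K g (k + 1)) (gfOfRecord F N K (k + 1)) (g (k + 1))
        (effActionHT F N (TcOnOfRecord F N ν) (chiFixed7 F N ν) K g (k + 1))) (fieldMeasure (F.P K) (k + 1) (SU N)) := by
      rw [B12Eq019ActionBody.integrand_eq]
      exact ((measurable_chiFixed7 F N ν K g (k + 1)).aemeasurable.mul
        (Real.measurable_exp.comp_aemeasurable
          (((measurable_const.mul (measurable_gfOfRecord K (k + 1))).aemeasurable).add hA))).aestronglyMeasurable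
    -- domination by `|c · TcOn ρ_k| + 1`
    refine Integrable.mono' ((hT.const_mul c).abs.add (integrable_const 1)) hmeas (Filter.Eventually.of_forall fun U => ?_)
    rw [Real.norm_eq_abs]
    refine (abs_integrand_le_exp (fun U => chiFixed7_nonneg F N ν K g (k + 1) U) (fun U => chiFixed7_le_one ν K g (k + 1) U)
      (gfOfRecord_nonneg K (k + 1)) (g (k + 1)) U).trans ?_
    rw [effActionHT_succ, nextAction_apply]
    exact exp_log_le_abs_add_one _

/-- **UNCONDITIONAL `IsRT` AT EVERY β-INPUT**: along `TcOnOfRecord ν` (χ slot `chiFixed7 ν`), at every torus `K`, history `g` and step `k < K`, the image of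
the (0.19) density met IS a renormalisation transformation of it — no continuity proviso anywhere. [cite: Balaban1985Averaging, (10) p.19; Balaban1987RG1, (0.19) p.255] -/
theorem isRT_TcOnOfRecord_beta (ν : Stage7Numerics) (K : ℕ) (g : ℕ → ℝ) {k : ℕ} (hk : k < K) :
    IsRT (avOfRecord F N K k).avg
      (integrand (chiFixed7 F N ν K g k) (gfOfRecord F N K k) (g k) (effActionHT F N (TcOnOfRecord F N ν) (chiFixed7 F N ν) K g k))
      (TcOnOfRecord F N ν K k
        (integrand (chiFixed7 F N ν K g k) (gfOfRecord F N K k) (g k) (effActionHT F N (TcOnOfRecord F N ν) (chiFixed7 F N ν) K g k))) :=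
  isRT_TcOnOfRecord ν hk (integrable_integrand_TcOnOfRecord ν K g hk.le)

variable (F N)

/-- **THE PRINT-SHAPED β-VERSION PROVISO OVER THE ON-DOMAIN TRANSPORT** — what a successor record would carry INSTEAD of `contT`: FILE 1's
`HasContTransportAlongDom` at `T := TcOnOfRecord θ.ν`, i.e. at every torus, history and step `k < K` the (0.19) density met along `TcOnOfRecord θ.ν` has a
transform of record with a version continuous ON `domAltOfRecord θ.ν K (k+1)` ([I] p. 259: `A_{k+1}` is read «on the space of configurations V for which
|∂V − 1| < ε₀»).  DISPLAYED, never asserted. [cite: Balaban1987RG1, (0.19) p.255, p.259 and (1.2) p.260] -/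
def Stage8Params.ContTOnDom (θ : Stage8Params F N) : Prop :=
  θ.HasContTransportAlongDom F N (TcOnOfRecord F N θ.ν)

variable {F N}

/-- **N09's PER-STEP TRIPLE FROM `ContTOnDom`**: at every torus `K`, history `g` and step `j < K`, the image under `TcOnOfRecord θ.ν` of the (0.19) density met is
an `IsRT` image (unconditional), integrable (unconditional) and continuous ON `domAltOfRecord θ.ν K (j+1)` (the proviso) — exactly the hypothesis `hstep` of
n09-a's `B12ContinuousTransportInvarianceOn.hCompT_of_stepsOn_chiFixed7` ∕ `thm3Member_of_indATPlug_of_stepsOn_chiFixed7`.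
[cite: Balaban1987RG1, (0.13) p.254, (0.19) p.255, p.259 and p.263] -/
theorem stepsOn_TcOnOfRecord {θ : Stage8Params F N} (h : θ.ContTOnDom F N) (K : ℕ) (g : ℕ → ℝ) :
    ∀ j < K,
      IsRT (avOfRecord F N K j).avg
          (integrand (chiFixed7 F N θ.ν K g j) (gfOfRecord F N K j) (g j) (effActionHT F N (TcOnOfRecord F N θ.ν) (chiFixed7 F N θ.ν) K g j))
          (TcOnOfRecord F N θ.ν K j
            (integrand (chiFixed7 F N θ.ν K g j) (gfOfRecord F N K j) (g j) (effActionHT F N (TcOnOfRecord F N θ.ν) (chiFixed7 F N θ.ν) K g j))) ∧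
        Integrable (TcOnOfRecord F N θ.ν K j
            (integrand (chiFixed7 F N θ.ν K g j) (gfOfRecord F N K j) (g j) (effActionHT F N (TcOnOfRecord F N θ.ν) (chiFixed7 F N θ.ν) K g j)))
          (fieldMeasure (F.P K) (j + 1) (SU N)) ∧
        ContinuousOn (TcOnOfRecord F N θ.ν K j
            (integrand (chiFixed7 F N θ.ν K g j) (gfOfRecord F N K j) (g j) (effActionHT F N (TcOnOfRecord F N θ.ν) (chiFixed7 F N θ.ν) K g j)))
          (domAltOfRecord F N θ.ν K (j + 1)) :=
  fun j hj => ⟨isRT_TcOnOfRecord_beta θ.ν K g hj, integrable_TcOnOfRecord θ.ν hj (integrable_integrand_TcOnOfRecord θ.ν K g hj.le),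
    continuousOn_TcOnOfRecord θ.ν (h K g j hj)⟩

/-- **N09's COMPOSITION INPUT `HCompT` OVER THE ON-DOMAIN TRANSPORT, FROM `ContTOnDom`** + the [B11] binders (`HRestrict`, intermediate orbit uniqueness) +
the nesting «averaged regular minimisers of small fields are small-field» — n09-a's `hCompT_of_stepsOn_chiFixed7` fed by `stepsOn_TcOnOfRecord`.  Nothing of
print asserted: every input is displayed. [cite: Balaban1987RG1, (1.1)–(1.3) p.260, (1.2) p.260 and p.263; Balaban1985Variational, Thm 1 p.279] -/
theorem hCompT_TcOnOfRecord_of_contTOnDom {θ : Stage8Params F N} (h : θ.ContTOnDom F N) {ε : ℝ} (K : ℕ) (g : ℕ → ℝ) {n : ℕ} (hn : n ≤ K)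
    {k : ℕ} (hk : k ≤ n) {dom : Set (GaugeField (F.P K) k (SU N))} (hres : HRestrict F N ε K k dom)
    (huniq : ∀ V ∈ dom, ∀ j < k, UniqueUkOrbit F N K (j + 1) ε (Averaging.iter (avOfRecord F N K) (j + 1) (Uk F N K k ε V)))
    (hnest : ∀ V ∈ dom, ∀ j < k, Averaging.iter (avOfRecord F N K) j (Uk F N K k ε V) ∈ domAltOfRecord F N θ.ν K j) :
    HCompT F N (TcOnOfRecord F N θ.ν) (chiFixed7 F N θ.ν) ε K g k dom :=
  hCompT_of_stepsOn_chiFixed7 (TcOnOfRecord F N θ.ν) θ.ν K g hn (fun j hj => stepsOn_TcOnOfRecord h K g j (lt_of_lt_of_le hj hn)) hk hres huniq hnest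

/-- The record's everywhere field does NOT feed this file's proviso (different transports: `ContTOnDom` is over `TcOnOfRecord`, `contT` over `TcOfRecord`); what
transfers for free is only the shape at one density: an everywhere proviso for the density met along `TcOnOfRecord` gives the on-domain one (FILE 1
`HasContTransportAt.on`). [cite: Balaban1987RG1, (0.13) p.254 (bookkeeping)] -/
theorem contTOnDom_of_forall_hasContTransportAt {θ : Stage8Params F N}
    (h : ∀ (K : ℕ) (g : ℕ → ℝ) (k : ℕ), k < K → HasContTransportAlongβ F N (TcOnOfRecord F N θ.ν) θ.ν K g k) : θ.ContTOnDom F N :=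
  fun K g k hk => (h K g k hk).on _

variable (F N)

/-- **The β of record READ THROUGH THE ON-DOMAIN TRANSPORT** (Stage-8 parameters; def-T's `betaOfRecord₈T` at `T := TcOnOfRecord θ.ν`): every input
`A_{k+1} = log(𝐍_k⁻¹·(T_k …)(V))` reads a function that IS a version of the kernel transform and, under `ContTOnDom`, is continuous and pointwise determined on
the small-field domain where print reads it.  OFFERED to the ₁₃ owner; bound by no record. [cite: Balaban1987RG1, (1.20)–(1.22) p.264 and p.259] -/
def betaOfRecord₈cOn (θ : Stage8Params F N) : HBeta := betaOfRecord₈T F N (TcOnOfRecord F N θ.ν) θ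

/-- The same over Stage-9 parameters. [cite: Balaban1987RG1, (1.20)–(1.22) p.264] -/
def betaOfRecord₉cOn (θ : Stage9Params F N) : HBeta := betaOfRecord₈cOn F N θ.toStage8Params

/-- Unfolding (`rfl`). [cite: Balaban1987RG1, (1.20)–(1.22) p.264 (bookkeeping)] -/
theorem betaOfRecord₉cOn_eq (θ : Stage9Params F N) : betaOfRecord₉cOn F N θ = betaOfRecord₈T F N (TcOnOfRecord F N θ.ν) θ.toStage8Params := rfl

end Beta

/-! ## §5. (v1.1) PROJECTION ₁₂ → SUCCESSOR: the record's everywhere field IMPLIES `ContTOnDom`, and along the β-layer the densities met over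
`TcOnOfRecord` ARE those met over `TcOfRecord` (so every ₁₂ consumer theorem transfers to a successor record keyed on the on-domain transport) -/

section Projection

variable {F : T4Family} {N : ℕ} [NeZero N]

/-- The unit configuration lies in every small-field domain of record when `0 < ε₀` (def-χ's `chiFixAltOfRecord_one`). [cite: Balaban1987RG1, p.259 (bookkeeping)] -/
theorem one_mem_domAltOfRecord (ν : Stage7Numerics) (hε : 0 < ν.ε₀) (K k : ℕ) : (1 : GaugeField (F.P K) k (SU N)) ∈ domAltOfRecord F N ν K k :=
  (chiFixAltOfRecord_eq_one_iff_mem ν K k 1).1 (chiFixAltOfRecord_one ν hε K k)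

/-- **UNDER THE EVERYWHERE PROVISO AT ONE DENSITY THE TWO TRANSPORTS AGREE ON THE DOMAIN**: if the transform of record of `ρ` has an everywhere continuous
version (def-T's `HasContTransportAt`), then `TcOnOfRecord ν K k ρ = TcOfRecord K k ρ` at every point of `domAltOfRecord ν K (k+1)` (determinacy on the open
domain: both are continuous there and a.e. equal to the kernel transform). [cite: Balaban1987RG1, (0.13) p.254 and p.259 (bookkeeping)] -/
theorem TcOnOfRecord_eqOn_TcOfRecord (ν : Stage7Numerics) {K k : ℕ} {ρ : Density (F.P K) k (SU N)} (h : HasContTransportAt F N K k ρ) :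
    EqOn (TcOnOfRecord F N ν K k ρ) (TcOfRecord F N K k ρ) (domAltOfRecord F N ν K (k + 1)) :=
  TcOnOfRecord_eqOn_of_continuousOn ν (continuous_TcOfRecord K k ρ).continuousOn (ae_restrict_of_ae (TcOfRecord_ae_eq h))

/-- **ALONG THE β-LAYER THE DENSITIES MET OVER `TcOnOfRecord ν` ARE THOSE MET OVER `TcOfRecord`** (`0 < ε₀`, the everywhere proviso at the steps `< K` as in
`Provisos₁₀.contT`), every `k ≤ K`: by induction — `A_0` does not read the transport; at `k + 1` the two `A_{k+1} = log 𝐍_k⁻¹(T_kρ_k)(·)` agree ON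
`domAltOfRecord ν K (k+1)` (previous lemma, also at `V = 1 ∈` domain for `𝐍_k`), and OFF it both densities vanish with `χ_{k+1} = 𝟙_{domAltOfRecord}`.
[cite: Balaban1987RG1, (0.17)–(0.19) p.255 and p.259] -/
theorem integrand_TcOnOfRecord_eq_of_hasContTransportAlongβ (ν : Stage7Numerics) (hε : 0 < ν.ε₀) (K : ℕ) (g : ℕ → ℝ)
    (hex : ∀ j < K, HasContTransportAlongβ F N (TcOfRecord F N) ν K g j) :
    ∀ {k : ℕ}, k ≤ K →
      integrand (chiFixed7 F N ν K g k) (gfOfRecord F N K k) (g k) (effActionHT F N (TcOnOfRecord F N ν) (chiFixed7 F N ν) K g k) =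
        integrand (chiFixed7 F N ν K g k) (gfOfRecord F N K k) (g k) (effActionHT F N (TcOfRecord F N) (chiFixed7 F N ν) K g k)
  | 0, _ => by rw [effActionHT_zero, effActionHT_zero]
  | k + 1, hk => by
    have hk' : k < K := Nat.lt_of_succ_le hk
    have ih := integrand_TcOnOfRecord_eq_of_hasContTransportAlongβ ν hε K g hex hk'.le
    have hdom : EqOn
        (TcOnOfRecord F N ν K k (integrand (chiFixed7 F N ν K g k) (gfOfRecord F N K k) (g k)
          (effActionHT F N (TcOfRecord F N) (chiFixed7 F N ν) K g k)))
        (TcOfRecord F N K k (integrand (chiFixed7 F N ν K g k) (gfOfRecord F N K k) (g k)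
          (effActionHT F N (TcOfRecord F N) (chiFixed7 F N ν) K g k)))
        (domAltOfRecord F N ν K (k + 1)) :=
      TcOnOfRecord_eqOn_TcOfRecord ν (hex k hk')
    funext V
    rw [integrand_apply, integrand_apply]
    by_cases hV : V ∈ domAltOfRecord F N ν K (k + 1)
    · rw [effActionHT_succ, effActionHT_succ, nextAction_apply, nextAction_apply, B12Eq019ActionBody.normConst_def,
        B12Eq019ActionBody.normConst_def, ih, hdom hV, hdom (one_mem_domAltOfRecord ν hε K (k + 1))]
    · rw [B12ContinuousTransportInvarianceOn.chiFixed7_eq_zero_of_not_mem ν K g (k + 1) V hV, zero_mul, zero_mul]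

/-- … hence, on the domains, the transported values agree too: `(TcOn ρ_k^{On})(V) = (Tc ρ_k^{c})(V)` for `V ∈ domAltOfRecord ν K (k+1)`, `k < K`.
[cite: Balaban1987RG1, (0.19) p.255 and p.259 (bookkeeping)] -/
theorem TcOnOfRecord_eqOn_TcOfRecord_beta (ν : Stage7Numerics) (hε : 0 < ν.ε₀) (K : ℕ) (g : ℕ → ℝ)
    (hex : ∀ j < K, HasContTransportAlongβ F N (TcOfRecord F N) ν K g j) {k : ℕ} (hk : k < K) :
    EqOn
      (TcOnOfRecord F N ν K k
        (integrand (chiFixed7 F N ν K g k) (gfOfRecord F N K k) (g k) (effActionHT F N (TcOnOfRecord F N ν) (chiFixed7 F N ν) K g k)))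
      (TcOfRecord F N K k
        (integrand (chiFixed7 F N ν K g k) (gfOfRecord F N K k) (g k) (effActionHT F N (TcOfRecord F N) (chiFixed7 F N ν) K g k)))
      (domAltOfRecord F N ν K (k + 1)) := by
  rw [integrand_TcOnOfRecord_eq_of_hasContTransportAlongβ ν hε K g hex hk.le]
  exact TcOnOfRecord_eqOn_TcOfRecord ν (hex k hk)

/-- … and the effective actions agree on the domains: `A_{k+1}^{On} = A_{k+1}^{c}` on `domAltOfRecord ν K (k+1)`, `k < K`.
[cite: Balaban1987RG1, (0.19) p.255 and p.259 (bookkeeping)] -/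
theorem effActionHT_TcOnOfRecord_eqOn (ν : Stage7Numerics) (hε : 0 < ν.ε₀) (K : ℕ) (g : ℕ → ℝ)
    (hex : ∀ j < K, HasContTransportAlongβ F N (TcOfRecord F N) ν K g j) {k : ℕ} (hk : k < K) :
    EqOn (effActionHT F N (TcOnOfRecord F N ν) (chiFixed7 F N ν) K g (k + 1)) (effActionHT F N (TcOfRecord F N) (chiFixed7 F N ν) K g (k + 1))
      (domAltOfRecord F N ν K (k + 1)) := by
  intro V hV
  have hdom := TcOnOfRecord_eqOn_TcOfRecord_beta ν hε K g hex hk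
  rw [integrand_TcOnOfRecord_eq_of_hasContTransportAlongβ ν hε K g hex hk.le] at hdom
  rw [effActionHT_succ, effActionHT_succ, nextAction_apply, nextAction_apply, B12Eq019ActionBody.normConst_def,
    B12Eq019ActionBody.normConst_def, integrand_TcOnOfRecord_eq_of_hasContTransportAlongβ ν hε K g hex hk.le, hdom hV,
    hdom (one_mem_domAltOfRecord ν hε K (k + 1))]

/-- **THE PROJECTION ₁₂ → SUCCESSOR**: at numerics with `0 < ε₀` (Stage-7 admissibility), the record's EVERYWHERE field `HasContTransportAlong`
(`Provisos₁₀.contT`, carried by `Provisos₁₂.base`) IMPLIES the successor's on-domain field `ContTOnDom` over `TcOnOfRecord` — so a successor record keyed on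
(`TcOnOfRecord`, `ContTOnDom`) is WEAKER than Stage 12 field by field, and its inhabitation at the K0′ carrier follows from K0′'s.
[cite: Balaban1987RG1, (0.13) p.254, (0.19) p.255 and p.259 (bookkeeping)] -/
theorem contTOnDom_of_hasContTransportAlong {θ : Stage8Params F N} (hε : 0 < θ.ν.ε₀) (h : θ.HasContTransportAlong) : θ.ContTOnDom F N := by
  intro K g k hk
  show HasContTransportOn F N K k _ (domAltOfRecord F N θ.ν K (k + 1))
  rw [integrand_TcOnOfRecord_eq_of_hasContTransportAlongβ θ.ν hε K g (fun j hj => h K g j hj) hk.le]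
  exact (h K g k hk).on _

/-- The same from a Stage-10 record's provisos at admissible numerics (at Stage 12: `h.base`). [cite: Balaban1987RG1, (0.13) p.254 (bookkeeping)] -/
theorem Stage9Params.Provisos₁₀.contTOnDom {θ : Stage9Params F N} (h : θ.Provisos₁₀) (hε : 0 < θ.ν.ε₀) : θ.toStage8Params.ContTOnDom F N :=
  contTOnDom_of_hasContTransportAlong (θ := θ.toStage8Params) hε h.contT

end Projection

end Literature.MathematicalPhysics.QuantumFieldTheory.Balaban1983to89.Node00

end
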